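import Summits.ResolutionOfSingularities.ResolutionOfSingularities.Theorems.WeightedInvariantIota3JFlat
import Summits.ResolutionOfSingularities.ResolutionOfSingularities.Theorems.WeightedInvariantIota3Regimes
import HarnessLib

/-!
# `PointDropOf Pos Tame ι p` — the (drop) statement for the EXACT-σ-FLAG-WEIGHT point centre, PARAMETRIC in the position class:
# (P3b-drop) = `Pos := IsIsolatedPosition`, (P3t-drop) = `Pos := IsTiePosition` (IOTA3-DESIGN v1.3 §8.4 rows ISOLATED / TIE)
# (door `HypersurfaceCentreConstruction`, stmt-ResolutionOfSingularities-19897; KEY `stub_localWeightedDropEFT4S`; P3 rung `stub_keyRung_dimLEThree`,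
# skeleton v3.7 / ladder `PRung d` p522114; ORDERS (o33-b)/(o37) sequel of res-L1-w43-plan-1; typer res-type-061)

Topic: `Summits/ResolutionOfSingularities/ResolutionOfSingularities/Theorems`. STATEMENT MODULE (one `Prop`-valued definition + trivial seams; NO
proof of any drop): IOTA3-DESIGN v1.3 §8.4 types TWO point-centre regimes with the SAME centre rule — the exact σ-attaining flag weights
`jSigmaPt` (p530288) — and the same expected mechanism («(P3t-drop): TAME ⇒ ATW transplant (twin of (P3b-drop)) … proof = the (P3b-drop)
prover»): ISOLATED (`Iota3.IsIsolatedPosition`, res-type-073 p530450 = the isolation hypothesis of `P3bDropOf`, p529577) and TIE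
(`Iota3.IsTiePosition`, res-type-092 (o36) `…Iota3Tie.lean`).  This file states the drop ONCE, parametric in the position class `Pos`:

* **`Iota3.PointDropOf Pos Tame ι p`** — for every position `S` (regular local, essentially of finite type over a perfect field of characteristic
  `p`, Krull dimension `≤ 3`), every `0 ≠ f ∈ 𝔪²` with `Pos S f` and `Tame S f`, and every σ-attaining two-flag `(g₁, g₂; q, r₁, r₂)` of `f`
  (`IsSigmaMaximiser`, p529577) with PRIMITIVE weights (`IsPrimitiveTriple`, p530288) completed by `x` to a regular system of parameters
  `(x, g₂, g₁)`: `WeightedDrop ι S f 𝔪 ![x, g₂, g₁] ![q, r₂, r₁]` (the (drop) conjunct of `CanonicalGameClause`, named in p529577).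
* `p3bDropOf_iff_pointDropOf : P3bDropOf Tame ι p ↔ PointDropOf IsIsolatedPosition Tame ι p` (`Iff.rfl` — (o33-b) IS the isolated instance);
  `PointDropOf.mono_pos` / `.mono_tame` / `.union` (a drop on `Pos₁` and on `Pos₂` is a drop on `Pos₁ ∨ Pos₂` — so ONE proof for the tame
  point-centre mechanism serves both rows) / `.drop` (modus ponens at a position).
* The TIE instance `P3tDropOf Tame ι p := PointDropOf (fun R _ _ f => IsTiePosition R f) Tame ι p` and `P3tDrop Tame p := P3tDropOf Tame iotaFlatT p`
  are one-liners over res-type-092's / res-type-013's modules and land in a sequel when those are in the tree.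

[OURS · candidates · conjecture-grade statements of OUR key's rung; nothing here asserts anything about Hironaka's problem; NOT a statement of the
manuscript under review (Hironaka 2017, [claim: Hironaka2017, status: under-review]); AI typing, weaker than expert review.]
-/

noncomputable section

open IsLocalRing Literature.AlgebraicGeometry.Resolution
open Summit.ResolutionOfSingularities.ResolutionOfSingularities.Theorems

set_option linter.dupNamespace false -- mandated namespace of this single-conjunct summit

namespace Summit.ResolutionOfSingularities.ResolutionOfSingularities.Cruxes.HypersurfaceCentreConstruction.LocalEngine

namespace Iota3

/-- [OURS · (o33-b)/(o37) sequel · candidate · conjecture-grade] **The point-centre drop statement, parametric in the position class `Pos`, the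
tameness cut `Tame` and the invariant `ι`.**  At every position `S` (regular local, essentially of finite type over a perfect field `k₀` of
characteristic `p`, `ringKrullDim S ≤ 3`) and every `f ≠ 0`, `f ∈ 𝔪²`, with `Pos S f` and `Tame S f`: for every σ-attaining two-flag
`(g₁, g₂; q, r₁, r₂)` of `f` (order `ν = iotaOrd S f`) with primitive weights, completed by `x` to a regular system of parameters `(x, g₂, g₁)` of
`S`, the weighted blow-up of the centre `𝔪` presented by `u = (x, g₂, g₁)`, `w = (q, r₂, r₁)` satisfies the (drop) conjunct for `ι`.
Instances of record: `Pos := IsIsolatedPosition` ((P3b-drop), `p3bDropOf_iff_pointDropOf`), `Pos := IsTiePosition` ((P3t-drop), sequel). -/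
def PointDropOf (Pos : (R : Type) → [CommRing R] → [IsLocalRing R] → R → Prop) (Tame : (R : Type) → [CommRing R] → R → Prop)
    (ι : (R : Type) → [CommRing R] → R → Ordinal.{0}) (p : ℕ) : Prop :=
  ∀ (k₀ : Type) [Field k₀] [CharP k₀ p] [PerfectField k₀]
    (S : Type) [CommRing S] [Algebra k₀ S] [Algebra.EssFiniteType k₀ S] [IsRegularLocalRing S] (f : S),
    ringKrullDim S ≤ 3 → f ≠ 0 → f ∈ (maximalIdeal S) ^ 2 →
    Pos S f → Tame S f →
    ∀ (ν : ℕ), iotaOrd S f = ν →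
    ∀ (x g₁ g₂ : S) (q r₁ r₂ : ℕ),
      Ideal.span {x, g₂, g₁} = maximalIdeal S → (maximalIdeal S).spanFinrank = 3 →
      IsSigmaMaximiser f ν g₁ g₂ q r₁ r₂ → IsPrimitiveTriple q r₁ r₂ →
      WeightedDrop ι S f (maximalIdeal S) ![x, g₂, g₁] ![q, r₂, r₁]

/-- **(P3b-drop) IS the isolated instance**: `P3bDropOf Tame ι p ↔ PointDropOf IsIsolatedPosition Tame ι p` (definitional: the isolation
hypothesis of `P3bDropOf` is `IsIsolatedPosition S f` and its primitivity hypothesis is `IsPrimitiveTriple q r₁ r₂`). [OURS · seam] -/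
theorem p3bDropOf_iff_pointDropOf (Tame : (R : Type) → [CommRing R] → R → Prop) (ι : (R : Type) → [CommRing R] → R → Ordinal.{0}) (p : ℕ) :
    P3bDropOf Tame ι p ↔ PointDropOf IsIsolatedPosition Tame ι p :=
  Iff.rfl

namespace PointDropOf

variable {Pos Pos' : (R : Type) → [CommRing R] → [IsLocalRing R] → R → Prop} {Tame Tame' : (R : Type) → [CommRing R] → R → Prop}
  {ι : (R : Type) → [CommRing R] → R → Ordinal.{0}} {p : ℕ}

/-- A SMALLER position class gives a WEAKER statement. [folklore] -/
theorem mono_pos (hP : ∀ (R : Type) [CommRing R] [IsLocalRing R] (g : R), Pos' R g → Pos R g) (h : PointDropOf Pos Tame ι p) :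
    PointDropOf Pos' Tame ι p :=
  fun k₀ _ _ _ S _ _ _ _ f hdim hf0 hf2 hpos htame ν hν x g₁ g₂ q r₁ r₂ hspan hrk hmax hprim =>
    h k₀ S f hdim hf0 hf2 (hP S f hpos) htame ν hν x g₁ g₂ q r₁ r₂ hspan hrk hmax hprim

/-- A STRONGER tameness cut gives a WEAKER statement. [folklore] -/
theorem mono_tame (hT : ∀ (R : Type) [CommRing R] (g : R), Tame' R g → Tame R g) (h : PointDropOf Pos Tame ι p) :
    PointDropOf Pos Tame' ι p :=
  fun k₀ _ _ _ S _ _ _ _ f hdim hf0 hf2 hpos htame ν hν x g₁ g₂ q r₁ r₂ hspan hrk hmax hprim =>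
    h k₀ S f hdim hf0 hf2 hpos (hT S f htame) ν hν x g₁ g₂ q r₁ r₂ hspan hrk hmax hprim

/-- **ONE proof serves two rows**: a drop on `Pos` and a drop on `Pos'` give the drop on `Pos ∨ Pos'` (e.g. ISOLATED ∨ TIE = the ε = 0
point-centre positions of dimension 3). [folklore] -/
theorem union (h : PointDropOf Pos Tame ι p) (h' : PointDropOf Pos' Tame ι p) :
    PointDropOf (fun R _ _ g => Pos R g ∨ Pos' R g) Tame ι p :=
  fun k₀ _ _ _ S _ _ _ _ f hdim hf0 hf2 hpos htame ν hν x g₁ g₂ q r₁ r₂ hspan hrk hmax hprim =>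
    hpos.elim (fun h₁ => h k₀ S f hdim hf0 hf2 h₁ htame ν hν x g₁ g₂ q r₁ r₂ hspan hrk hmax hprim)
      (fun h₂ => h' k₀ S f hdim hf0 hf2 h₂ htame ν hν x g₁ g₂ q r₁ r₂ hspan hrk hmax hprim)

/-- Conversely the drop on a union gives the drop on each part. [folklore] -/
theorem of_union_left (h : PointDropOf (fun R _ _ g => Pos R g ∨ Pos' R g) Tame ι p) : PointDropOf Pos Tame ι p :=
  mono_pos (fun _ _ _ _ hg => Or.inl hg) h

/-- Conversely the drop on a union gives the drop on each part. [folklore] -/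
theorem of_union_right (h : PointDropOf (fun R _ _ g => Pos R g ∨ Pos' R g) Tame ι p) : PointDropOf Pos' Tame ι p :=
  mono_pos (fun _ _ _ _ hg => Or.inr hg) h

/-- Modus ponens at a position: the (drop) conjunct text for the exact-flag-weight centre. [folklore] -/
theorem drop (h : PointDropOf Pos Tame ι p) (k₀ : Type) [Field k₀] [CharP k₀ p] [PerfectField k₀]
    (S : Type) [CommRing S] [Algebra k₀ S] [Algebra.EssFiniteType k₀ S] [IsRegularLocalRing S] (f : S)
    (hdim : ringKrullDim S ≤ 3) (hf0 : f ≠ 0) (hf2 : f ∈ (maximalIdeal S) ^ 2) (hpos : Pos S f) (htame : Tame S f)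
    {ν : ℕ} (hν : iotaOrd S f = ν) {x g₁ g₂ : S} {q r₁ r₂ : ℕ}
    (hspan : Ideal.span {x, g₂, g₁} = maximalIdeal S) (hrk : (maximalIdeal S).spanFinrank = 3)
    (hmax : IsSigmaMaximiser f ν g₁ g₂ q r₁ r₂) (hprim : IsPrimitiveTriple q r₁ r₂) :
    WeightedDrop ι S f (maximalIdeal S) ![x, g₂, g₁] ![q, r₂, r₁] :=
  h k₀ S f hdim hf0 hf2 hpos htame ν hν x g₁ g₂ q r₁ r₂ hspan hrk hmax hprim

/-- The centre of the statement IS `J₃` of record at such positions: at an ε ≠ 1 point-centre position of dimension 3 the attaining flag's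
filtration lies in `jFlat S f` (p530288 `flagContactFiltration_le_jFlat`) — the (pres)/(adm) side of the (c9′) witness is `jSigmaPt`'s. [folklore] -/
theorem centre_le_jFlat (S : Type) [CommRing S] [IsLocalRing S] {f : S} (hf0 : f ≠ 0) (hfu : ¬ IsUnit f)
    (h : ContactCylinder.topStratumPrime iotaOrdEps S f = maximalIdeal S) (hdim : ¬ ringKrullDim S ≤ 2)
    {g₁ g₂ : S} {q r₁ r₂ : ℕ} (hmax : IsSigmaMaximiser f (adicOrder f).toNat g₁ g₂ q r₁ r₂) (hprim : IsPrimitiveTriple q r₁ r₂) (m : ℕ) :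
    flagContactFiltration g₁ g₂ q r₁ r₂ m ≤ jFlat S f m :=
  flagContactFiltration_le_jFlat S hf0 hfu h hdim hmax hprim m

end PointDropOf

end Iota3

end Summit.ResolutionOfSingularities.ResolutionOfSingularities.Cruxes.HypersurfaceCentreConstruction.LocalEngine

end
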